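import Literature.Algebra.EuclideanLattices.DualGridAttemptSpec
import Mathlib.GroupTheory.QuotientGroup.Basic
import HarnessLib

/-!
# The query of one attempt as a function on the finite group `(1/N)ℤⁿ/L(S)`: the model `𝔾`, its map to the offsets, the `S`-coordinate embedding

Topic `Algebra/EuclideanLattices` (family `pqc`), sequel of `DualGridAttemptSpec.lean` (one attempt of
the `SIS`-based short-vector step on `Λ = G ℤⁿ ⊇ L(S)`: the query entries
`aⱼ = ⌊q σⱼ⌋ mod q`, `σ = GT (B C + N Dg κ)/modM`, `modM = dT·N·Dg`). Micciancio–Regev's proof of the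
first property of Lemma 5.8 ("if `C` is uniform then `A` is uniform", authors' version p. 21) reads
the point `w = rep c + v` in the finite group `L'/L(S)` (`L' = (1/N)ℤⁿ` here): `c` uniform on `L'/Λ` and
`v` uniform on `Λ/L(S)` make `w` uniform on `L'/L(S)`, and `a = ⌊q S⁻¹ w⌋` is then (nearly) uniform.
This file builds that finite group and the maps the argument needs, all on INTEGER vectors
(grid units), everything PROVED:

* `MM = modM` as a natural number, `castM`, `HS ≤ (ℤ/MM)ⁿ` (the image of `N·L(S)`, i.e. of
  `z ↦ N ∑ⱼ zⱼ sⱼ`), **`GG B N S = (ℤ/MM)ⁿ ⧸ HS`** (`≅ L'/L(S)`, a `Fintype`), `mkG K = [K]`;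
* **`psi : GG →+ Grp B N`** (`L'/L(S) → L'/Λ`, induced by `ℤ/MM → ℤ/Mo`), the section
  **`sec c = [crepInt c]`** (`crepInt c = reduceVec (liftVec c)`, the reduced representative; `psi_sec`), and
  the kernel: `psi (mkG (N G κ)) = 0`, `exists_eq_kerVec_of_psi_eq_zero` (`ker ψ = {[N G κ]} ≅ Λ/L(S)`);
* **`xiBar : GG →+ (ℤ/MM)ⁿ`**, `[K] ↦ GT B K` (`S`-coordinates times `modM`; well defined because
  `GT B (N ∑ zⱼ sⱼ) = modM · z`, using `GT TS = dT I`), with `xiBar_mkG_S` : `xiBar [sⱼ] = (dT·Dg) eⱼ` — a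
  step of `sⱼ/N` moves the `j`-th `S`-coordinate by `1/N` — and `xiBar_mkG_add_sum`;
* the QUERY as a function on `GG`: `queryOf g j = ⌊q · val((xiBar g)ⱼ)/MM⌋ mod q`, and
  **`aEntOf_eq_queryOf`**: the machine's entry `aEnt` computed from `(C, κ) = (crepInt c, κ)` is
  `queryOf (sec c + mkG (N G κ))` (`(qV/M) mod q = ⌊q (V mod M)/M⌋`).

## References

* D. Micciancio, O. Regev, *Worst-case to average-case reductions based on Gaussian measures*,
  SIAM J. Comput. 37 (2007) 267–302; authors' version, Lemma 5.8 and its proof (p. 21, "We now prove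
  the first property").
-/

noncomputable section

open scoped Classical

namespace Literature.Algebra.EuclideanLattices

open Module Submodule Matrix GSInverse Finset

namespace DualGrid

variable {n : ℕ}

/-! ### A one-sided scalar inverse of a square integer matrix is two-sided -/

/-- If `A B = c I` with `c ≠ 0` for square integer matrices, then `B A = c I`. [folklore] -/
theorem mul_eq_smul_one_comm {A B : Matrix (Fin n) (Fin n) ℤ} {c : ℤ} (hc : c ≠ 0)
    (h : A * B = c • (1 : Matrix (Fin n) (Fin n) ℤ)) : B * A = c • (1 : Matrix (Fin n) (Fin n) ℤ) := by
  have hinj : Function.Injective (fun M : Matrix (Fin n) (Fin n) ℤ => M.map (Int.cast : ℤ → ℚ)) :=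
    fun M M' h => Matrix.ext fun i j => by
      have := congrFun (congrFun h i) j
      simpa [Matrix.map_apply] using this
  apply hinj
  have hc' : (c : ℚ) ≠ 0 := by exact_mod_cast hc
  have hAB : A.map (Int.cast : ℤ → ℚ) * ((c : ℚ)⁻¹ • B.map (Int.cast : ℤ → ℚ)) = 1 := by
    rw [Matrix.mul_smul, show A.map (Int.cast : ℤ → ℚ) * B.map (Int.cast : ℤ → ℚ) = (A * B).map (Int.cast : ℤ → ℚ) from
      (Matrix.map_mul (f := Int.castRingHom ℚ)).symm, h]
    ext i j
    rw [Matrix.smul_apply, Matrix.map_apply, Matrix.smul_apply, Matrix.one_apply, Matrix.one_apply]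
    split_ifs <;> simp [hc']
  have hBA := mul_eq_one_comm.1 hAB
  rw [Matrix.smul_mul] at hBA
  have e : (B * A).map (Int.cast : ℤ → ℚ) = B.map (Int.cast : ℤ → ℚ) * A.map (Int.cast : ℤ → ℚ) :=
    Matrix.map_mul (f := Int.castRingHom ℚ)
  show (B * A).map (Int.cast : ℤ → ℚ) = (c • (1 : Matrix (Fin n) (Fin n) ℤ)).map (Int.cast : ℤ → ℚ)
  rw [e]
  have : B.map (Int.cast : ℤ → ℚ) * A.map (Int.cast : ℤ → ℚ) = (c : ℚ) • (1 : Matrix (Fin n) (Fin n) ℚ) := by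
    have := congrArg (fun M => (c : ℚ) • M) hBA
    simp only [smul_smul, mul_inv_cancel₀ hc', one_smul] at this
    exact this
  rw [this]
  ext i j
  rw [Matrix.map_apply, Matrix.smul_apply, Matrix.smul_apply, Matrix.one_apply, Matrix.one_apply]
  split_ifs <;> simp

variable (B : Matrix (Fin n) (Fin n) ℤ) (N : ℕ) (S : Fin n → Fin n → ℤ)

/-! ### The group `𝔾 = (ℤ/MM)ⁿ ⧸ image(N·L(S))` -/

/-- `MM = modM = dT·N·Dg` as a natural number. [folklore] -/
def MM : ℕ := (modM B N S).toNat

/-- Casting an integer vector modulo `MM`. [folklore] -/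
def castM : (Fin n → ℤ) →+ (Fin n → ZMod (MM B N S)) where
  toFun K := fun i => (K i : ZMod (MM B N S))
  map_zero' := by funext i; simp
  map_add' K K' := by funext i; simp

/-- `castM K i = K i mod MM`. [folklore] -/
@[simp] theorem castM_apply (K : Fin n → ℤ) (i : Fin n) : castM B N S K i = (K i : ZMod (MM B N S)) := rfl

/-- `z ↦ N ∑ⱼ zⱼ sⱼ` (the vectors of `N · L(S)`, in grid units). [folklore] -/
def scaledS : (Fin n → ℤ) →+ (Fin n → ℤ) where
  toFun z := N • ∑ j, z j • S j
  map_zero' := by simp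
  map_add' z z' := by
    rw [← smul_add, ← Finset.sum_add_distrib]
    congr 1
    exact Finset.sum_congr rfl fun j _ => by rw [Pi.add_apply, add_smul]

/-- `scaledS z = N • ∑ zⱼ sⱼ`. [folklore] -/
@[simp] theorem scaledS_apply (z : Fin n → ℤ) : scaledS N S z = N • ∑ j, z j • S j := rfl

/-- The subgroup `HS = image of N·L(S)` of `(ℤ/MM)ⁿ`. [folklore] -/
def HS : AddSubgroup (Fin n → ZMod (MM B N S)) := ((castM B N S).comp (scaledS N S)).range

/-- **The finite group `𝔾 = (ℤ/MM)ⁿ ⧸ HS`** modelling `(1/N)ℤⁿ / L(S)`. [cite: MicciancioRegev2007, Lemma 5.8 (proof of (i): L(B) mod P(S))] -/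
abbrev GG : Type := (Fin n → ZMod (MM B N S)) ⧸ HS B N S

/-- `𝔾` is finite (needs `MM ≠ 0`). [folklore] -/
instance instFintypeGG [NeZero (MM B N S)] : Fintype (GG B N S) := QuotientAddGroup.fintype (HS B N S)

/-- The class `[K] ∈ 𝔾` of an integer vector. [folklore] -/
def mkG (K : Fin n → ℤ) : GG B N S := QuotientAddGroup.mk' (HS B N S) (castM B N S K)

/-- `mkG` is additive. [folklore] -/
theorem mkG_add (K K' : Fin n → ℤ) : mkG B N S (K + K') = mkG B N S K + mkG B N S K' := by
  simp [mkG]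

/-- `mkG` is onto (every class has an integer representative). [folklore] -/
theorem mkG_surjective [NeZero (MM B N S)] : Function.Surjective (mkG B N S) := by
  intro g
  obtain ⟨v, rfl⟩ := QuotientAddGroup.mk'_surjective (HS B N S) g
  refine ⟨fun i => ((v i).val : ℤ), ?_⟩
  rw [mkG]; congr 1; funext i
  rw [castM_apply, Int.cast_natCast, ZMod.natCast_zmod_val]

variable {B N S}

/-- Two integer vectors have the same class in `𝔾` iff they differ by `N ∑ zⱼ sⱼ + MM ℓ`. [folklore] -/
theorem mkG_eq_mkG_iff (K K' : Fin n → ℤ) :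
    mkG B N S K = mkG B N S K' ↔ ∃ (z ℓ : Fin n → ℤ), K' = K + N • ∑ j, z j • S j + (MM B N S : ℤ) • ℓ := by
  rw [mkG, mkG, QuotientAddGroup.mk'_eq_mk']
  constructor
  · rintro ⟨h, hh, hK⟩
    obtain ⟨z, rfl⟩ := hh
    have hcoord : ∀ i, ((K' i - (K i + (N • ∑ j, z j • S j) i) : ℤ) : ZMod (MM B N S)) = 0 := by
      intro i
      have := congrFun hK i
      simp only [Pi.add_apply, castM_apply, AddMonoidHom.coe_comp, Function.comp_apply, scaledS_apply] at this
      push_cast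
      rw [← this]
      ring
    choose ℓ hℓ using fun i => (ZMod.intCast_zmod_eq_zero_iff_dvd _ _).1 (hcoord i)
    refine ⟨z, ℓ, funext fun i => ?_⟩
    have := hℓ i
    simp only [Pi.add_apply, Pi.smul_apply, smul_eq_mul] at this ⊢
    linarith
  · rintro ⟨z, ℓ, rfl⟩
    refine ⟨castM B N S (N • ∑ j, z j • S j), ⟨z, rfl⟩, funext fun i => ?_⟩
    simp only [Pi.add_apply, castM_apply, Pi.smul_apply, smul_eq_mul]
    push_cast
    rw [ZMod.natCast_self, zero_mul, add_zero]

/-! ### Facts needing the hypotheses: `MM`, `GT TS = dT I`, `B sⱼ = Dg τⱼ` -/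

section Hyp

variable (hB : B.det ≠ 0) [NeZero N] (hS : ∀ j, intVecToEuclidean n (S j) ∈ dualLat B)
  (hli : LinearIndependent ℝ fun j => intVecToEuclidean n (S j))

include hB hS hli

/-- `(MM : ℤ) = modM`. [folklore] -/
theorem MM_eq : ((MM B N S : ℕ) : ℤ) = modM B N S := Int.toNat_of_nonneg (modM_pos hB hS hli).le

/-- `MM ≠ 0`. [folklore] -/
theorem neZero_MM : NeZero (MM B N S) :=
  ⟨fun h => by
    have := MM_eq (N := N) hB hS hli
    rw [h, Nat.cast_zero] at this
    linarith [modM_pos (N := N) hB hS hli]⟩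

/-- `MM = dT.toNat · Mo`. [folklore] -/
theorem MM_eq_mul_Mo : MM B N S = (dT B S).toNat * Mo B N := by
  have h1 : ((MM B N S : ℕ) : ℤ) = ((dT B S).toNat * Mo B N : ℕ) := by
    rw [MM_eq hB hS hli, modM, Nat.cast_mul, Int.toNat_of_nonneg (dT_pos hB hS hli).le, Mo, Nat.cast_mul,
      Int.toNat_of_nonneg (Dg_pos hB).le]
  exact_mod_cast h1

/-- `Mo ∣ MM`. [folklore] -/
theorem Mo_dvd_MM : Mo B N ∣ MM B N S := ⟨(dT B S).toNat, by rw [MM_eq_mul_Mo hB hS hli, mul_comm]⟩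

/-- `GT TS = dT I`. [cite: Cohen1993, §2.6.3] -/
theorem GT_mul_TS : GT B S * TS B S = dT B S • (1 : Matrix (Fin n) (Fin n) ℤ) :=
  mul_eq_smul_one_comm (dT_pos hB hS hli).ne' (TS_mul_GT hB hS hli)

omit hli in
/-- `B sⱼ = Dg τⱼ`. [folklore] -/
theorem B_mulVec_S (j : Fin n) : B *ᵥ S j = Dg B • tauVec B S j := by
  conv_lhs => rw [← G_mulVec_tauVec hB (hS j)]
  rw [B_mulVec_G_mulVec hB]

omit hli in
/-- `∑ⱼ zⱼ sⱼ = G (TS z)`. [folklore] -/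
theorem sum_smul_S_eq (z : Fin n → ℤ) : ∑ j, z j • S j = G B *ᵥ (TS B S *ᵥ z) := by
  have hcol : ∀ j, S j = G B *ᵥ tauVec B S j := fun j => (G_mulVec_tauVec hB (hS j)).symm
  conv_lhs => rw [show (fun j => z j • S j) = fun j => z j • (G B *ᵥ tauVec B S j) from funext fun j => by rw [← hcol j]]
  rw [show ∑ j, z j • (G B *ᵥ tauVec B S j) = G B *ᵥ ∑ j, z j • tauVec B S j by
    rw [Matrix.mulVec_sum]; exact Finset.sum_congr rfl fun j _ => (Matrix.mulVec_smul _ _ _).symm]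
  congr 1
  funext l
  simp only [Matrix.mulVec, dotProduct, TS, Matrix.of_apply, Finset.sum_apply, Pi.smul_apply, smul_eq_mul]
  exact Finset.sum_congr rfl fun j _ => mul_comm _ _

omit [NeZero N] in
/-- `GT B (N ∑ zⱼ sⱼ) = modM · z`: the vectors of `N·L(S)` have `S`-coordinates in `MM·ℤⁿ`. [folklore] -/
theorem GT_B_scaledS (z : Fin n → ℤ) : GT B S *ᵥ (B *ᵥ (N • ∑ j, z j • S j)) = modM B N S • z := by
  rw [sum_smul_S_eq hB hS, Matrix.mulVec_smul, B_mulVec_G_mulVec hB, Matrix.mulVec_smul, Matrix.mulVec_smul,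
    Matrix.mulVec_mulVec, GT_mul_TS hB hS hli, Matrix.smul_mulVec, Matrix.one_mulVec, ← natCast_zsmul, smul_smul,
    smul_smul, modM]
  congr 1
  ring

omit hB hS hli [NeZero N] in
/-- `τⱼ` is the `j`-th column of `TS`. [folklore] -/
theorem tauVec_eq_col (j : Fin n) : tauVec B S j = (TS B S).col j := by
  funext l; simp [TS, Matrix.col]

/-- `GT B sⱼ = (dT·Dg) eⱼ`. [folklore] -/
theorem GT_B_S (j : Fin n) : GT B S *ᵥ (B *ᵥ S j) = (dT B S * Dg B) • Pi.single j 1 := by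
  rw [B_mulVec_S hB hS, Matrix.mulVec_smul, tauVec_eq_col, ← Matrix.mulVec_single_one, Matrix.mulVec_mulVec,
    GT_mul_TS hB hS hli, Matrix.smul_mulVec, Matrix.one_mulVec, smul_smul, mul_comm]

end Hyp

variable (B N S)

/-! ### The `S`-coordinate embedding `Ξ̄ : 𝔾 →+ (ℤ/MM)ⁿ` -/

/-- The matrix `GT · B` reduced modulo `MM`, as a map of `(ℤ/MM)ⁿ`. [folklore] -/
def xiMod : (Fin n → ZMod (MM B N S)) →+ (Fin n → ZMod (MM B N S)) :=
  (Matrix.mulVecLin ((GT B S * B).map (Int.castRingHom (ZMod (MM B N S))))).toAddMonoidHom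

/-- `xiMod (K mod MM) = (GT B K) mod MM`. [folklore] -/
theorem xiMod_castM (K : Fin n → ℤ) : xiMod B N S (castM B N S K) = castM B N S (GT B S *ᵥ (B *ᵥ K)) := by
  funext i
  simp only [xiMod, LinearMap.toAddMonoidHom_coe, Matrix.mulVecLin_apply, Matrix.mulVec_mulVec]
  have h := (RingHom.map_mulVec (Int.castRingHom (ZMod (MM B N S))) (GT B S * B) K i).symm
  simp only [castM_apply, eq_intCast] at h ⊢
  convert h using 2
  funext l; simp [castM_apply]

section Hyp2

variable {B N S}
variable (hB : B.det ≠ 0) [NeZero N] (hS : ∀ j, intVecToEuclidean n (S j) ∈ dualLat B)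
  (hli : LinearIndependent ℝ fun j => intVecToEuclidean n (S j))

include hB hS hli

/-- `HS ≤ ker xiMod`: `GT B (N ∑ zⱼ sⱼ) = modM · z ≡ 0`. [folklore] -/
theorem HS_le_ker_xiMod : HS B N S ≤ (xiMod B N S).ker := by
  rintro h ⟨z, rfl⟩
  rw [AddMonoidHom.mem_ker, AddMonoidHom.coe_comp, Function.comp_apply, scaledS_apply, xiMod_castM,
    GT_B_scaledS hB hS hli]
  funext i
  simp only [castM_apply, Pi.smul_apply, smul_eq_mul, Pi.zero_apply, Int.cast_mul]
  rw [← MM_eq (N := N) hB hS hli, Int.cast_natCast, ZMod.natCast_self, zero_mul]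

end Hyp2

/-- **The `S`-coordinate embedding `Ξ̄ : 𝔾 →+ (ℤ/MM)ⁿ`, `[K] ↦ GT B K mod MM`** (defined by the universal
property; the hypotheses guarantee that `HS` is killed). [cite: MicciancioRegev2007, Lemma 5.8 (step 3: S⁻¹ wᵢ)] -/
def xiBar (hker : HS B N S ≤ (xiMod B N S).ker) : GG B N S →+ (Fin n → ZMod (MM B N S)) :=
  QuotientAddGroup.lift (HS B N S) (xiMod B N S) hker

/-- `Ξ̄ [K] = GT B K mod MM`. [folklore] -/
theorem xiBar_mkG (hker : HS B N S ≤ (xiMod B N S).ker) (K : Fin n → ℤ) :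
    xiBar B N S hker (mkG B N S K) = castM B N S (GT B S *ᵥ (B *ᵥ K)) := by
  rw [← xiMod_castM]
  exact QuotientAddGroup.lift_mk (HS B N S) hker (castM B N S K)

section Hyp3

variable {B N S}
variable (hB : B.det ≠ 0) [NeZero N] (hS : ∀ j, intVecToEuclidean n (S j) ∈ dualLat B)
  (hli : LinearIndependent ℝ fun j => intVecToEuclidean n (S j))

include hB hS hli

/-- **`Ξ̄ [sⱼ] = (dT·Dg) eⱼ`**: a step of `sⱼ/N` moves the `j`-th `S`-coordinate numerator by
`dT·Dg = MM/N`. [folklore] -/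
theorem xiBar_mkG_S (j : Fin n) :
    xiBar B N S (HS_le_ker_xiMod hB hS hli) (mkG B N S (S j)) =
      Pi.single j (((dT B S * Dg B : ℤ) : ZMod (MM B N S))) := by
  rw [xiBar_mkG, GT_B_S hB hS hli]
  funext i
  simp only [castM_apply, Pi.smul_apply, Pi.single_apply, smul_eq_mul]
  split_ifs <;> simp

/-- `Ξ̄ (g₀ + ∑ⱼ kⱼ [sⱼ]) = Ξ̄ g₀ + (dT·Dg) · k`. [folklore] -/
theorem xiBar_add_sum (g₀ : GG B N S) (k : Fin n → ℕ) :
    xiBar B N S (HS_le_ker_xiMod hB hS hli) (g₀ + ∑ j, k j • mkG B N S (S j)) =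
      xiBar B N S (HS_le_ker_xiMod hB hS hli) g₀ + fun i => ((dT B S * Dg B : ℤ) : ZMod (MM B N S)) * k i := by
  rw [map_add, map_sum]
  congr 1
  funext i
  rw [Finset.sum_apply, Finset.sum_eq_single i]
  · rw [map_nsmul, xiBar_mkG_S hB hS hli, Pi.smul_apply, Pi.single_eq_same, nsmul_eq_mul, mul_comm]
  · intro j _ hj
    rw [map_nsmul, xiBar_mkG_S hB hS hli, Pi.smul_apply, Pi.single_eq_of_ne (Ne.symm hj), smul_zero]
  · exact fun h => (h (Finset.mem_univ i)).elim

end Hyp3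

/-! ### The map to the offsets `ψ : 𝔾 →+ Grp` and its section -/

/-- Casting `(ℤ/MM)ⁿ → (ℤ/Mo)ⁿ` (`Mo ∣ MM`). [folklore] -/
def downVec (hdvd : Mo B N ∣ MM B N S) : (Fin n → ZMod (MM B N S)) →+ (Fin n → ZMod (Mo B N)) where
  toFun v := fun i => ZMod.castHom hdvd (ZMod (Mo B N)) (v i)
  map_zero' := by funext i; exact map_zero (ZMod.castHom hdvd (ZMod (Mo B N)))
  map_add' v w := by funext i; exact map_add (ZMod.castHom hdvd (ZMod (Mo B N))) (v i) (w i)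

/-- `downVec (K mod MM) = K mod Mo`. [folklore] -/
theorem downVec_castM (hdvd : Mo B N ∣ MM B N S) (K : Fin n → ℤ) : downVec B N S hdvd (castM B N S K) = castVec B N K := by
  funext i
  change ZMod.castHom hdvd (ZMod (Mo B N)) ((K i : ZMod (MM B N S))) = (K i : ZMod (Mo B N))
  exact map_intCast _ _

section Hyp4

variable {B N S}
variable (hB : B.det ≠ 0) [NeZero N] (hS : ∀ j, intVecToEuclidean n (S j) ∈ dualLat B)
  (hli : LinearIndependent ℝ fun j => intVecToEuclidean n (S j))

include hB hS hli

omit [NeZero N] hli in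
/-- `HS` maps into `Hsub`: `N ∑ zⱼ sⱼ = N G (TS z)`. [folklore] -/
theorem HS_le_comap (hdvd : Mo B N ∣ MM B N S) : HS B N S ≤ (Hsub B N).comap (downVec B N S hdvd) := by
  rintro h ⟨z, rfl⟩
  rw [AddSubgroup.mem_comap, AddMonoidHom.coe_comp, Function.comp_apply, scaledS_apply, downVec_castM,
    sum_smul_S_eq hB hS]
  exact ⟨TS B S *ᵥ z, rfl⟩

end Hyp4

/-- **The map `ψ : 𝔾 →+ Grp`** (`L'/L(S) → L'/Λ`, as `L(S) ⊆ Λ`). [cite: MicciancioRegev2007, Lemma 5.8 (proof of (i))] -/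
def psi (hdvd : Mo B N ∣ MM B N S) (hle : HS B N S ≤ (Hsub B N).comap (downVec B N S hdvd)) : GG B N S →+ Grp B N :=
  QuotientAddGroup.map (HS B N S) (Hsub B N) (downVec B N S hdvd) hle

/-- `ψ [K] = [K mod Mo]`. [folklore] -/
theorem psi_mkG (hdvd : Mo B N ∣ MM B N S) (hle : HS B N S ≤ (Hsub B N).comap (downVec B N S hdvd)) (K : Fin n → ℤ) :
    psi B N S hdvd hle (mkG B N S K) = QuotientAddGroup.mk' (Hsub B N) (castVec B N K) := by
  rw [psi, mkG, QuotientAddGroup.map_mk', downVec_castM]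
  rfl

/-- The reduced integer representative `crepInt c = reduceVec (liftVec c)` of an offset class
(`rep c = crepInt c / N`). [cite: MicciancioRegev2007, Lemma 5.7 (c = -r mod P(B))] -/
def crepInt (c : Grp B N) : Fin n → ℤ := reduceVec B N (liftVec B N c)

/-- `rep c = fineGridEquiv (crepInt c)`. [folklore] -/
theorem rep_eq_fineGridEquiv_crepInt [NeZero N] (c : Grp B N) : rep B N c = fineGridEquiv n N (crepInt B N c) := rfl

/-- **The section `sec : Grp → 𝔾`, `c ↦ [crepInt c]`.** [folklore] -/
def sec (c : Grp B N) : GG B N S := mkG B N S (crepInt B N c)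

variable {B N S}

/-- `ψ ∘ sec = id`. [folklore] -/
theorem psi_sec (hB : B.det ≠ 0) [NeZero N] (hdvd : Mo B N ∣ MM B N S)
    (hle : HS B N S ≤ (Hsub B N).comap (downVec B N S hdvd)) (c : Grp B N) :
    psi B N S hdvd hle (sec B N S c) = c := by
  rw [sec, psi_mkG, crepInt, mk_castVec_reduceVec, mk_castVec_liftVec hB]

/-- **The kernel vectors**: `ψ [N G κ] = 0`. [folklore] -/
theorem psi_mkG_kerVec (hdvd : Mo B N ∣ MM B N S) (hle : HS B N S ≤ (Hsub B N).comap (downVec B N S hdvd))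
    (κ : Fin n → ℤ) : psi B N S hdvd hle (mkG B N S (N • (G B *ᵥ κ))) = 0 := by
  rw [psi_mkG]
  exact (QuotientAddGroup.eq_zero_iff _).2 ⟨κ, rfl⟩

/-- **The kernel is `{[N G κ]}`**: if `ψ [K] = 0` then `K = N G κ` for some integer `κ` (so
`[K] = [N G κ]`). [folklore] -/
theorem exists_eq_kerVec_of_psi_mkG_eq_zero (hB : B.det ≠ 0) [NeZero N] (hdvd : Mo B N ∣ MM B N S)
    (hle : HS B N S ≤ (Hsub B N).comap (downVec B N S hdvd)) {K : Fin n → ℤ}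
    (hK : psi B N S hdvd hle (mkG B N S K) = 0) : ∃ κ : Fin n → ℤ, K = N • (G B *ᵥ κ) := by
  have hDg : ((Dg B).toNat : ℤ) = Dg B := Int.toNat_of_nonneg (Dg_pos hB).le
  rw [psi_mkG, show (0 : Grp B N) = QuotientAddGroup.mk' (Hsub B N) (castVec B N 0) by simp, eq_comm,
    mk_castVec_eq_iff] at hK
  obtain ⟨d, ℓ, hK⟩ := hK
  refine ⟨d + B *ᵥ ℓ, ?_⟩
  rw [hK, zero_add, Matrix.mulVec_add, G_mulVec_B_mulVec hB, smul_add]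
  congr 1
  funext i
  simp only [Pi.smul_apply, smul_eq_mul, nsmul_eq_mul, Mo, Nat.cast_mul, hDg]
  ring

/-! ### The query as a function on `𝔾` -/

variable (B N S)

/-- **The query column as a function on `𝔾`**: `queryOf g j = ⌊q · val((Ξ̄ g)ⱼ)/MM⌋ mod q`.
[cite: MicciancioRegev2007, Lemma 5.8 (step 3: aᵢ = ⌊q S⁻¹wᵢ⌋)] -/
def queryOf (hker : HS B N S ≤ (xiMod B N S).ker) (q : ℕ) (g : GG B N S) (j : Fin n) : ZMod q :=
  ((q * ((xiBar B N S hker g) j).val / MM B N S : ℕ) : ZMod q)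

variable {B N S}

/-- `V = GT B (C + N G κ)`: the numerators of the `S`-coordinates through the integer map. [folklore] -/
theorem VnumOf_eq (hB : B.det ≠ 0) (C κ : Fin n → ℤ) : VnumOf B N S C κ = GT B S *ᵥ (B *ᵥ (C + N • (G B *ᵥ κ))) := by
  rw [VnumOf, Matrix.mulVec_add B C, Matrix.mulVec_smul, B_mulVec_G_mulVec hB, ← natCast_zsmul, smul_smul]

/-- `(qV/M) mod q`, read in `ℤ/q`, is `⌊q (V mod M)/M⌋` for the representative of `V` in `[0, M)`. [folklore] -/
theorem cast_mul_ediv_eq (q : ℕ) {M : ℕ} (hM : 0 < M) (V : ℤ) :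
    ((((q : ℤ) * V / (M : ℤ)) : ℤ) : ZMod q) = ((q * ((V : ZMod M).val) / M : ℕ) : ZMod q) := by
  haveI : NeZero M := ⟨hM.ne'⟩
  have hval : (((V : ZMod M).val : ℕ) : ℤ) = V % M := ZMod.val_intCast V
  have hM0 : (M : ℤ) ≠ 0 := by exact_mod_cast hM.ne'
  have hV : V = V % M + M * (V / M) := (Int.emod_add_mul_ediv V M).symm
  have h1 : (q : ℤ) * V / M = (q : ℤ) * (V % M) / M + q * (V / M) := by
    conv_lhs => rw [hV]
    rw [mul_add, show (q : ℤ) * ((M : ℤ) * (V / M)) = (q * (V / M)) * M by ring, Int.add_mul_ediv_right _ _ hM0]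
  rw [h1, Int.cast_add, Int.cast_mul, Int.cast_natCast, ZMod.natCast_self, zero_mul, add_zero, ← hval,
    show (q : ℤ) * (((V : ZMod M).val : ℕ) : ℤ) = ((q * (V : ZMod M).val : ℕ) : ℤ) by push_cast; ring,
    ← Int.natCast_div, Int.cast_natCast]

variable (B N S)

/-- The query entry computed from an integer offset representative `C` and `κ`:
`aEntOf q C κ j = (q V / modM) mod q`, `V = VnumOf C κ` (`aEnt` is the case `C = crep K`).
[cite: MicciancioRegev2007, Lemma 5.8 (step 3)] -/
def aEntOf (q : ℕ) (C κ : Fin n → ℤ) (j : Fin n) : ℤ := ((q : ℤ) * VnumOf B N S C κ j / modM B N S) % q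

/-- `aEnt` is `aEntOf` at the representative `crep K`. [folklore] -/
theorem aEnt_eq_aEntOf (q : ℕ) (K κ : Fin n → ℤ) (j : Fin n) : aEnt B N S q K κ j = aEntOf B N S q (crep B N K) κ j := rfl

variable {B N S}

/-- **The machine's query entry is the query function on `𝔾`**: read in `ℤ/q`,
`aEntOf q C κ j = queryOf (mkG C + mkG (N G κ)) j`. [cite: MicciancioRegev2007, Lemma 5.8 (step 3)] -/
theorem cast_aEntOf_eq_queryOf (hB : B.det ≠ 0) [NeZero N] (hS : ∀ j, intVecToEuclidean n (S j) ∈ dualLat B)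
    (hli : LinearIndependent ℝ fun j => intVecToEuclidean n (S j)) (q : ℕ) (C κ : Fin n → ℤ) (j : Fin n) :
    ((aEntOf B N S q C κ j : ℤ) : ZMod q) =
      queryOf B N S (HS_le_ker_xiMod hB hS hli) q (mkG B N S C + mkG B N S (N • (G B *ᵥ κ))) j := by
  have hMpos : 0 < MM B N S := Nat.pos_of_ne_zero (neZero_MM (N := N) hB hS hli).ne
  rw [aEntOf, ZMod.intCast_mod, ← MM_eq (N := N) hB hS hli, cast_mul_ediv_eq q hMpos, queryOf, ← mkG_add, xiBar_mkG,
    ← VnumOf_eq hB]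
  rfl

end DualGrid

end Literature.Algebra.EuclideanLattices

end
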